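import Summits.QuantumAdvantage.AdviceFreeQNC0.RingCanonical
import Literature.Computability.MetaComplexity.SmolenskyProperty
import Mathlib.Algebra.Field.ZMod
import HarnessLib

/-!
# Cell qa-qnc0 — an affine ring strategy failing on exactly one `S₃`-slice (all `n`)

A simpler sibling of planner qa-qnc0-p2's 5/6 map `zSixth` (`SixthMap.lean`), with a proof for
EVERY ring length `n ≥ 3`: flip the first bit of the canonical guess `t_j = x_j ⊕ x_{j+1}` exactly
on the odd class,

  `zFlip(x)_0 = x_0 ⊕ x_1 ⊕ [#zeros(x) odd]`,   `zFlip(x)_j = x_j ⊕ x_{j+1}` (`j ≥ 1`)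

(an AFFINE map over `𝔽₂`: `[#zeros odd] = n + Σ_i x_i`). By `RingCanonical.rel_tGuess_iff` the
guess `t` is right on the even class and wrong against the kernel line `v⋆(x)` on the odd class
(`⟨t, v⋆⟩ = ℓ_x(v⋆) + 1`, `dot2_tGuess_kernelLine`); flipping bit `0` repairs this iff `v⋆_0 = 1`,
i.e. iff the initial state `fixVec (sigmaSum x)` has second coordinate `1`, i.e. iff
`sigmaSum x ≠ 0`:

* `rel_zFlip_iff` — `Rel x (zFlip x) ↔ (#zeros(x) even ∨ sigmaSum x ≠ 0)`; the failure set is the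
  single slice `{#zeros odd, sigmaSum = 0}` of the `S₃`-valued monodromy (one of six classes,
  of density `→ 1/6`);
* `rel_iff_odd_stake` — planner qa-qnc0-p1's K6 betting form for all `n`: on the odd class,
  `Rel x z ↔ |supp(z ⊕ t(x)) ∩ supp v⋆(x)|` is odd;
* `stake_loses_some_residue` — the three candidate kernel lines `kernelVec x (fixVec S)` are
  `𝔽₂`-dependent, so no stake wins against all three residues of `sigmaSum` (p1's "bet against a
  `MOD₃` residue", all `n`);
* `rel_stake01_iff` — planner qa-qnc0-p2's E1 in kernel form, all `n`: with stakes on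
  positions `0, 1` only, validity on the odd class is a three-residue game in `sigmaSum x`;
* `tGuess_mem_lowDeg_one`, `zFlip_mem_lowDeg_one` — both strategies are affine: every output bit
  lies in the tree's `Smolensky.lowDeg (ZMod 2) n 1`.

So for every `n` a degree-1 strategy fails only on one monodromy class; the crux `RingHard 2` asks
whether polylog degree can push the failure probability to `0`.

WHAT THIS IS NOT: the exact count `|{#zeros odd, sigmaSum = 0}| = ⌊2ⁿ/6⌋` or `(2ⁿ+2)/6` is not
proved here (planner qa-qnc0-p2 / referee numerics).
-/

namespace Summit.QuantumAdvantage.AdviceFreeQNC0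

open Finset Literature.Computability.QuantumComplexity Literature.Computability.QuantumComplexity.RingHLF

variable {n : ℕ}

/-! ### Linearity of trajectories in the initial state -/

/-- The transfer map is `𝔽₂`-linear in the state. -/
theorem tstep_xor (b : Bool) (s s' : St) :
    tstep b (xor s.1 s'.1, xor s.2 s'.2) = (xor (tstep b s).1 (tstep b s').1, xor (tstep b s).2 (tstep b s').2) := by
  obtain ⟨p, q⟩ := s; obtain ⟨p', q'⟩ := s'
  cases b <;> cases p <;> cases q <;> cases p' <;> cases q' <;> rfl

/-- Trajectories are `𝔽₂`-linear in the initial state. -/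
theorem iter_xor (x : Fin n → Bool) (s s' : St) :
    ∀ k, k ≤ n → iter x k (xor s.1 s'.1, xor s.2 s'.2) =
      (xor (iter x k s).1 (iter x k s').1, xor (iter x k s).2 (iter x k s').2) := by
  intro k
  induction k with
  | zero => intro _; simp
  | succ k ih =>
    intro hk
    rw [iter_succ x (by omega), iter_succ x (by omega), iter_succ x (by omega), ih (by omega), tstep_xor]

/-- **Linearity of kernel trajectories**: `kernelVec x (s ⊕ s') = kernelVec x s ⊕ kernelVec x s'`. -/
theorem kernelVec_xor (x : Fin n → Bool) (s s' : St) (k : Fin n) :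
    kernelVec x (xor s.1 s'.1, xor s.2 s'.2) k = xor (kernelVec x s k) (kernelVec x s' k) := by
  unfold kernelVec
  rw [iter_xor x s s' k.val k.isLt.le]

/-- The three fixed states of the transposition classes sum to zero: `fixVec 0 ⊕ fixVec 1 = fixVec 2`. -/
theorem fixVec_xor : (xor (fixVec 0).1 (fixVec 1).1, xor (fixVec 0).2 (fixVec 1).2) = fixVec 2 := by decide

/-- The flip map: `t` with bit `0` flipped on the odd class. -/
def zFlip (x : Fin n → Bool) (j : Fin n) : Bool :=
  if j.val = 0 then xor (tGuess x j) (reflBit (List.ofFn x)) else tGuess x j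

/-- On the odd class the canonical guess is wrong against the kernel line by exactly one:
`⟨t, v⋆⟩ ≡ ℓ_x(v⋆) + 1 (mod 2)`. -/
theorem dot2_tGuess_kernelLine (hn : 3 ≤ n) (x : Fin n → Bool) (hodd : reflBit (List.ofFn x) = true) :
    dot2 (kernelVec x (fixVec (sigmaSum (List.ofFn x)))) (tGuess x) =
      (signBit x (kernelVec x (fixVec (sigmaSum (List.ofFn x)))) + 1) % 2 := by
  set v := kernelVec x (fixVec (sigmaSum (List.ofFn x))) with hvdef
  have hv : InKernel x v := (kernel_odd hn x hodd v).2 (Or.inr rfl)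
  have hQ := Q_of_inKernel hn hv
  have hfix : monodromy (List.ofFn x) (fixVec (sigmaSum (List.ofFn x))) =
      fixVec (sigmaSum (List.ofFn x)) := by
    rw [monodromy_eq_dict, hodd, dict_true_fixed_iff]; exact Or.inr rfl
  have hs0 : (v ⟨n - 1, by omega⟩, v ⟨0, by omega⟩) = fixVec (sigmaSum (List.ofFn x)) := by
    refine Prod.ext ?_ ?_
    · have h1 := iter_succ_fst x (show n - 1 < n by omega) (fixVec (sigmaSum (List.ofFn x)))
      rw [show n - 1 + 1 = n by omega, iter_length, hfix] at h1
      simp only [hvdef, kernelVec]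
      exact h1.symm
    · simp [hvdef, kernelVec]
  rw [hs0, hodd] at hQ
  have hQ2 : ∀ S : ZMod 3, qtab true S (fixVec S) = 2 := by decide
  rw [hQ2] at hQ
  obtain ⟨c2, hc2⟩ := even_wtAnd_of_inKernel' hn hv
  unfold dot2 signBit
  rw [hc2, show c2 + c2 = 2 * c2 by ring, Nat.mul_div_cancel_left _ (by norm_num : 0 < 2)]
  rw [hc2] at hQ
  set D := (univ.filter fun b : Fin n => v b = true ∧ tGuess x b = true).card
  set E := edgesIn v
  push_cast at hQ
  have h4 : ((2 * D : ℕ) : ZMod 4) = ((2 * E + 2 * c2 + 2 : ℕ) : ZMod 4) := by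
    push_cast; linear_combination hQ
  have := (ZMod.natCast_eq_natCast_iff' (2 * D) (2 * E + 2 * c2 + 2) 4).1 h4
  omega

/-- Flipping output bit `0` changes the pairing with `v` by `v_0`. -/
private theorem dot2_flip_zero (hn : 3 ≤ n) (v z : Fin n → Bool) :
    dot2 v (fun j => if j.val = 0 then xor (z j) true else z j) =
      (dot2 v z + (if v ⟨0, by omega⟩ = true then 1 else 0)) % 2 := by
  unfold dot2
  rw [card_filter, card_filter, Nat.add_mod, Nat.mod_mod, ← Nat.add_mod]
  rw [← Finset.sum_erase_add _ _ (mem_univ (⟨0, by omega⟩ : Fin n)),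
    ← Finset.sum_erase_add univ (fun b : Fin n => if (v b = true ∧ z b = true) then 1 else 0)
      (mem_univ (⟨0, by omega⟩ : Fin n))]
  have hrest : ∀ b ∈ univ.erase (⟨0, by omega⟩ : Fin n),
      (if (v b = true ∧ (if b.val = 0 then xor (z b) true else z b) = true) then 1 else 0 : ℕ) =
        if (v b = true ∧ z b = true) then 1 else 0 := by
    intro b hb
    have hb0 : b.val ≠ 0 := fun h => (Finset.mem_erase.1 hb).1 (Fin.ext h)
    simp [hb0]
  rw [Finset.sum_congr rfl hrest]
  simp only [if_true]
  rw [add_assoc, Nat.add_mod, Nat.add_mod (∑ x ∈ _, _)]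
  congr 2
  cases v ⟨0, by omega⟩ <;> cases z ⟨0, by omega⟩ <;> simp

/-- **The flip-map law, all `n ≥ 3`**: `zFlip` solves the ring relation exactly off the slice
`{#zeros(x) odd, sigmaSum x = 0}`. -/
theorem rel_zFlip_iff (hn : 3 ≤ n) (x : Fin n → Bool) :
    Rel x (zFlip x) ↔ (reflBit (List.ofFn x) = false ∨ sigmaSum (List.ofFn x) ≠ 0) := by
  by_cases hrb : reflBit (List.ofFn x) = true
  · -- odd class: `zFlip = t` with bit 0 flipped; valid iff `v⋆_0 = 1` iff `sigmaSum ≠ 0`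
    have hz : zFlip x = fun j => if j.val = 0 then xor (tGuess x j) true else tGuess x j := by
      funext j; simp [zFlip, hrb]
    set S := sigmaSum (List.ofFn x) with hS
    set v := kernelVec x (fixVec S) with hvdef
    have hv0 : v ⟨0, by omega⟩ = (fixVec S).2 := by simp [hvdef, kernelVec]
    rw [hz]
    simp only [hrb, Bool.true_eq_false, false_or]
    constructor
    · intro hrel hS0
      have hv : InKernel x v := (kernel_odd hn x hrb v).2 (Or.inr rfl)
      have hd := hrel v hv
      have hfx : (fixVec S).2 = false := by rw [hS0]; rfl
      rw [dot2_flip_zero hn, dot2_tGuess_kernelLine hn x hrb, ← hS, ← hvdef, hv0, hfx] at hd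
      have hlt : signBit x v < 2 := Nat.mod_lt _ (by norm_num)
      simp only [Bool.false_eq_true, if_false, add_zero] at hd
      omega
    · intro hS0 w hw
      rcases (kernel_odd hn x hrb w).1 hw with rfl | rfl
      · -- the zero vector pairs to `0` and has sign bit `0`
        unfold dot2 signBit edgesIn wtAnd
        simp
      · rw [dot2_flip_zero hn, ← hS, ← hvdef, dot2_tGuess_kernelLine hn x hrb, ← hS, ← hvdef, hv0]
        have hfx : (fixVec S).2 = true := by
          have h3 : ∀ T : ZMod 3, T ≠ 0 → (fixVec T).2 = true := by decide
          exact h3 S hS0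
        rw [hfx, if_pos rfl]
        have hlt : signBit x v < 2 := Nat.mod_lt _ (by norm_num)
        omega
  · -- even class: `zFlip = t`
    rw [Bool.not_eq_true] at hrb
    have hz : zFlip x = tGuess x := by
      funext j; simp [zFlip, hrb]
    rw [hz, rel_tGuess_iff hn]
    simp [hrb]

/-! ### The betting form of the ring relation on the odd class (planner qa-qnc0-p1's K6) -/

/-- `dot2` is additive in the second argument modulo `2`. -/
private theorem dot2_xor (v z w : Fin n → Bool) :
    dot2 v (fun k => xor (z k) (w k)) = (dot2 v z + dot2 v w) % 2 := by
  unfold dot2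
  rw [card_filter, card_filter, card_filter, Nat.add_mod, Nat.mod_mod, Nat.mod_mod, ← Nat.add_mod,
    ← sum_add_distrib, Finset.sum_nat_mod, Finset.sum_congr rfl fun b _ => ?_, ← Finset.sum_nat_mod]
  have key : ∀ (vb zb wb : Bool), (if (vb = true ∧ (xor zb wb) = true) then 1 else 0 : ℕ) % 2 =
      ((if (vb = true ∧ zb = true) then 1 else 0) + (if (vb = true ∧ wb = true) then 1 else 0)) % 2 := by
    decide
  exact key (v b) (z b) (w b)

/-- **The odd class as a betting game** (planner qa-qnc0-p1's K6, all `n ≥ 3`): on a pattern `x`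
with an odd number of zeros, an output `z` is valid iff the "stake" `w = z ⊕ t(x)` (the deviation
from the canonical guess) meets the support of the kernel line `v⋆(x)` in an ODD number of
positions. (On the even class `t` itself is valid, `RingCanonical.rel_tGuess_iff`.) -/
theorem rel_iff_odd_stake (hn : 3 ≤ n) (x : Fin n → Bool) (hodd : reflBit (List.ofFn x) = true)
    (z : Fin n → Bool) :
    Rel x z ↔ dot2 (kernelVec x (fixVec (sigmaSum (List.ofFn x)))) (fun k => xor (z k) (tGuess x k)) = 1 := by
  have hv : InKernel x (kernelVec x (fixVec (sigmaSum (List.ofFn x)))) :=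
    (kernel_odd hn x hodd _).2 (Or.inr rfl)
  have ht := dot2_tGuess_kernelLine hn x hodd
  have hlt1 : dot2 (kernelVec x (fixVec (sigmaSum (List.ofFn x)))) z < 2 := Nat.mod_lt _ (by norm_num)
  have hlt2 : signBit x (kernelVec x (fixVec (sigmaSum (List.ofFn x)))) < 2 := Nat.mod_lt _ (by norm_num)
  rw [dot2_xor, ht]
  constructor
  · intro hrel
    have hd := hrel _ hv
    rw [hd]
    omega
  · intro hodd' w hw
    rcases (kernel_odd hn x hodd w).1 hw with rfl | rfl
    · unfold dot2 signBit edgesIn wtAnd; simp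
    · omega

/-- `dot2` is additive in the first argument modulo `2`. -/
private theorem dot2_xor_left (v v' z : Fin n → Bool) :
    dot2 (fun k => xor (v k) (v' k)) z = (dot2 v z + dot2 v' z) % 2 := by
  unfold dot2
  rw [card_filter, card_filter, card_filter, Nat.add_mod, Nat.mod_mod, Nat.mod_mod, ← Nat.add_mod,
    ← sum_add_distrib, Finset.sum_nat_mod, Finset.sum_congr rfl fun b _ => ?_, ← Finset.sum_nat_mod]
  have key : ∀ (vb vb' zb : Bool), (if ((xor vb vb') = true ∧ zb = true) then 1 else 0 : ℕ) % 2 =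
      ((if (vb = true ∧ zb = true) then 1 else 0) + (if (vb' = true ∧ zb = true) then 1 else 0)) % 2 := by
    decide
  exact key (v b) (v' b) (z b)

/-- **No stake beats all three residues** (planner qa-qnc0-p1: "bet AGAINST a `MOD₃` residue"): for
any pattern `x` and any stake vector `w`, the pairings of `w` with the three candidate kernel lines
`kernelVec x (fixVec S)`, `S = 0, 1, 2` (one of which is the true `v⋆(x)` on the odd class, namely
`S = sigmaSum x`) sum to `0` modulo `2` — the three lines are `𝔽₂`-dependent (`fixVec 0 ⊕ fixVec 1
= fixVec 2`, trajectories are linear). So every stake loses against at least one residue: a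
strategy that cannot distinguish the residues of `sigmaSum x` fails on `≥ 1/3` of the odd class. -/
theorem stake_loses_some_residue (x : Fin n → Bool) (w : Fin n → Bool) :
    ∃ S : ZMod 3, dot2 (kernelVec x (fixVec S)) w = 0 := by
  by_contra h
  simp only [not_exists] at h
  have h0 : dot2 (kernelVec x (fixVec 0)) w = 1 := by
    have := Nat.mod_lt (univ.filter fun b : Fin n => kernelVec x (fixVec 0) b = true ∧ w b = true).card
      (show 0 < 2 by norm_num)
    unfold dot2 at h ⊢; have h' := h 0; omega
  have h1 : dot2 (kernelVec x (fixVec 1)) w = 1 := by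
    have := Nat.mod_lt (univ.filter fun b : Fin n => kernelVec x (fixVec 1) b = true ∧ w b = true).card
      (show 0 < 2 by norm_num)
    unfold dot2 at h ⊢; have h' := h 1; omega
  have h2 : dot2 (kernelVec x (fixVec 2)) w = 1 := by
    have := Nat.mod_lt (univ.filter fun b : Fin n => kernelVec x (fixVec 2) b = true ∧ w b = true).card
      (show 0 < 2 by norm_num)
    unfold dot2 at h ⊢; have h' := h 2; omega
  -- `kernelVec x (fixVec 2) = kernelVec x (fixVec 0) ⊕ kernelVec x (fixVec 1)`
  have hlin : kernelVec x (fixVec 2) = fun k => xor (kernelVec x (fixVec 0) k) (kernelVec x (fixVec 1) k) := by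
    funext k
    rw [← kernelVec_xor, fixVec_xor]
  rw [hlin, dot2_xor_left, h0, h1] at h2
  exact absurd h2 (by norm_num)

/-! ### Stakes on the first two positions: the residue game (planner qa-qnc0-p2's E1, kernel form) -/

/-- The first two coordinates of the kernel line `v⋆(x)` on the odd class:
`v⋆_0 = (fixVec S).2`, `v⋆_1 = (fixVec S).1 ⊕ x_0·(fixVec S).2`, `S = sigmaSum x`. -/
theorem kernelLine_zero_one (hn : 3 ≤ n) (x : Fin n → Bool) :
    kernelVec x (fixVec (sigmaSum (List.ofFn x))) ⟨0, by omega⟩ = (fixVec (sigmaSum (List.ofFn x))).2 ∧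
    kernelVec x (fixVec (sigmaSum (List.ofFn x))) ⟨1, by omega⟩ =
      xor (fixVec (sigmaSum (List.ofFn x))).1 (x ⟨0, by omega⟩ && (fixVec (sigmaSum (List.ofFn x))).2) := by
  constructor
  · simp [kernelVec]
  · show (iter x (0 + 1) _).2 = _
    rw [iter_succ x (by omega), iter_zero]
    rfl

/-- A stake supported on positions `0, 1` pairs with `v` through `v_0, v_1` only. -/
private theorem dot2_stake01 (hn : 3 ≤ n) (v : Fin n → Bool) (w0 w1 : Bool) :
    dot2 v (fun k => if k.val = 0 then w0 else if k.val = 1 then w1 else false) =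
      ((if (v ⟨0, by omega⟩ && w0) = true then 1 else 0) + (if (v ⟨1, by omega⟩ && w1) = true then 1 else 0)) % 2 := by
  unfold dot2
  congr 1
  rw [card_filter]
  have h0 : 0 < n := by omega
  have h1 : 1 < n := by omega
  have hne : (⟨1, h1⟩ : Fin n) ≠ ⟨0, h0⟩ := fun h => absurd (congrArg Fin.val h) (by norm_num)
  rw [← Finset.sum_erase_add _ _ (mem_univ (⟨0, h0⟩ : Fin n)),
    ← Finset.sum_erase_add _ _ (Finset.mem_erase.2 ⟨hne, mem_univ (⟨1, h1⟩ : Fin n)⟩)]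
  rw [Finset.sum_eq_zero]
  · simp only [zero_add, one_ne_zero, if_false, if_true]
    rw [add_comm]
    congr 1
    · cases v ⟨0, by omega⟩ <;> cases w0 <;> rfl
    · cases v ⟨1, by omega⟩ <;> cases w1 <;> rfl
  · intro k hk
    rw [Finset.mem_erase, Finset.mem_erase] at hk
    have h0 : k.val ≠ 0 := fun h => hk.2.1 (Fin.ext h)
    have h1 : k.val ≠ 1 := fun h => hk.1 (Fin.ext h)
    simp [h0, h1]

/-- **E1 in kernel form (all `n ≥ 3`)**: on the odd class, the strategy "canonical guess `t` plus
stakes `w_0, w_1` on positions `0, 1`" is valid iff the stakes win the THREE-RESIDUE GAME in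
`S = sigmaSum x`: `S = 0`: `w_1 = 1`; `S = 1`: `w_0 ⊕ w_1·(1 ⊕ x_0) = 1`; `S = 2`:
`w_0 ⊕ w_1·x_0 = 1` — planner qa-qnc0-p2's embedding of the elimination game (E1), with the
residue read in dictionary coordinates. -/
theorem rel_stake01_iff (hn : 3 ≤ n) (x : Fin n → Bool) (hodd : reflBit (List.ofFn x) = true)
    (w0 w1 : Bool) :
    Rel x (fun k => xor (tGuess x k) (if k.val = 0 then w0 else if k.val = 1 then w1 else false)) ↔
      (xor ((fixVec (sigmaSum (List.ofFn x))).2 && w0)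
        ((xor (fixVec (sigmaSum (List.ofFn x))).1 (x ⟨0, by omega⟩ && (fixVec (sigmaSum (List.ofFn x))).2)) && w1))
        = true := by
  rw [rel_iff_odd_stake hn x hodd]
  have hw : (fun k : Fin n => xor (xor (tGuess x k) (if k.val = 0 then w0 else if k.val = 1 then w1 else false))
      (tGuess x k)) = fun k => if k.val = 0 then w0 else if k.val = 1 then w1 else false := by
    funext k
    cases tGuess x k <;> simp
  rw [hw, dot2_stake01 hn, (kernelLine_zero_one hn x).1, (kernelLine_zero_one hn x).2]
  generalize (fixVec (sigmaSum (List.ofFn x))) = s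
  obtain ⟨s1, s2⟩ := s
  simp only
  cases s1 <;> cases s2 <;> cases w0 <;> cases w1 <;> cases x ⟨0, by omega⟩ <;> decide

/-! ### The strategies `t` and `zFlip` are affine over `𝔽₂` -/

section Degree

open Literature.Computability.MetaComplexity Literature.Computability.MetaComplexity.Smolensky

/-- The `𝔽₂`-indicator of a coordinate is the monomial `x_{j}`. -/
private theorem ind_coord_eq_mono (j : Fin n) :
    (fun x : Fin n → Bool => if x j = true then (1 : ZMod 2) else 0) = mono (ZMod 2) {j} := by
  funext x
  rw [mono_apply]
  simp

/-- The `𝔽₂`-indicator of an `xor` is the sum of the indicators. -/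
private theorem ind_xor (a b : Bool) :
    (if (xor a b) = true then (1 : ZMod 2) else 0) =
      (if a = true then (1 : ZMod 2) else 0) + (if b = true then (1 : ZMod 2) else 0) := by
  revert a b; decide

/-- **`t` is affine**: every output bit of `tGuess` has `𝔽₂`-degree `≤ 1`. -/
theorem tGuess_mem_lowDeg_one (j : Fin n) :
    (fun x : Fin n → Bool => if tGuess x j = true then (1 : ZMod 2) else 0) ∈ lowDeg (ZMod 2) n 1 := by
  have h : (fun x : Fin n → Bool => if tGuess x j = true then (1 : ZMod 2) else 0) =
      mono (ZMod 2) {j} + mono (ZMod 2) {nxt j} := by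
    rw [← ind_coord_eq_mono, ← ind_coord_eq_mono]
    funext x
    simp only [tGuess, Pi.add_apply]
    exact ind_xor _ _
  rw [h]
  exact Submodule.add_mem _ (mono_mem_lowDeg (by simp)) (mono_mem_lowDeg (by simp))

/-- The `𝔽₂`-indicator of "odd number of zeros" is the affine function `n + Σ_i x_i`. -/
private theorem ind_reflBit_eq (x : Fin n → Bool) :
    (if reflBit (List.ofFn x) = true then (1 : ZMod 2) else 0) =
      (n : ZMod 2) + ∑ i : Fin n, mono (ZMod 2) {i} x := by
  -- `[reflBit] = #zeros (mod 2)`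
  have h1 : (if reflBit (List.ofFn x) = true then (1 : ZMod 2) else 0) =
      ((Finset.univ.filter fun i : Fin n => x i = false).card : ZMod 2) := by
    by_cases h : reflBit (List.ofFn x) = true
    · rw [if_pos h]
      exact (ZMod.natCast_eq_one_iff_odd.2 ((reflBit_ofFn_iff x).1 h)).symm
    · rw [if_neg h]
      have he : Even ((Finset.univ.filter fun i : Fin n => x i = false).card) := by
        rcases Nat.even_or_odd _ with he | ho
        · exact he
        · exact absurd ((reflBit_ofFn_iff x).2 ho) h
      exact (ZMod.natCast_eq_zero_iff_even.2 he).symm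
  rw [h1, natCast_card_filter]
  -- `#zeros = n − #ones = n + #ones` in characteristic `2`
  have h2 : ∀ i : Fin n, (if x i = false then (1 : ZMod 2) else 0) = 1 + mono (ZMod 2) {i} x := by
    intro i
    rw [mono_apply]
    simp only [Finset.mem_singleton, forall_eq]
    cases x i <;> decide
  simp_rw [h2]
  rw [sum_add_distrib, sum_const, card_univ, Fintype.card_fin, nsmul_eq_mul, mul_one]

/-- **`zFlip` is affine**: every output bit of `zFlip` has `𝔽₂`-degree `≤ 1`. -/
theorem zFlip_mem_lowDeg_one (j : Fin n) :
    (fun x : Fin n → Bool => if zFlip x j = true then (1 : ZMod 2) else 0) ∈ lowDeg (ZMod 2) n 1 := by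
  by_cases hj : j.val = 0
  · have h : (fun x : Fin n → Bool => if zFlip x j = true then (1 : ZMod 2) else 0) =
        (fun x => if tGuess x j = true then (1 : ZMod 2) else 0) +
          ((n : ZMod 2) • mono (ZMod 2) (∅ : Finset (Fin n)) + ∑ i : Fin n, mono (ZMod 2) {i}) := by
      funext x
      simp only [zFlip, hj, if_true, Pi.add_apply, Pi.smul_apply, Finset.sum_apply, mono_empty,
        Pi.one_apply, smul_eq_mul, mul_one]
      rw [ind_xor, ind_reflBit_eq]
    rw [h]
    refine Submodule.add_mem _ (tGuess_mem_lowDeg_one j) (Submodule.add_mem _ ?_ ?_)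
    · exact Submodule.smul_mem _ _ (mono_mem_lowDeg (by simp))
    · exact Submodule.sum_mem _ fun i _ => mono_mem_lowDeg (by simp)
  · have h : (fun x : Fin n → Bool => if zFlip x j = true then (1 : ZMod 2) else 0) =
        fun x => if tGuess x j = true then (1 : ZMod 2) else 0 := by
      funext x; simp [zFlip, hj]
    rw [h]
    exact tGuess_mem_lowDeg_one j

end Degree

end Summit.QuantumAdvantage.AdviceFreeQNC0
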